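import Mathlib
import HarnessLib
import Literature.NumberTheory.LFunctions.ZetaScrew
import Literature.NumberTheory.LFunctions.ZetaScrewLogTwoPos
import Literature.Analysis.SpecialFunctions.EulerMascheroniBounds
import Summits.RiemannHypothesis.RiemannHypothesis.Theorems.IntegerScrewDefs
import Summits.RiemannHypothesis.RiemannHypothesis.Theorems.IntegerScrewNestedSylvester
import Summits.RiemannHypothesis.RiemannHypothesis.Theorems.IntegerScrewPivotCriterion

/-!
# Route `IntegerScrew` — the SECOND RUNG, unconditionally: `det S_3 > 0`, `d_3 > 0`, `S_3 ≻ 0`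

The pivot criterion (`riemannHypothesis_iff_screwPivot_pos`) reads RH as `d_M > 0` for all `M ≥ 2`;
the base `d_2 = 2Ψ(log 2) > 0` is `zetaScrew_log_two_pos`. Here: the next rung, RH-free, by interval
arithmetic — a kernel-checked instance of the cell's certified ladders (HOME/pivot/PIVOT-LAW.md §9.5
P-T2) and a template for importing them. METHOD («rank-one trick»): every entry of `S_M` contains
`C = Σ_k (k+¼)^{−2}` with the PSD pattern `(C/4)(J + I)`, and `det S_3` is increasing in `C` on the
relevant range, so the partial sum `C ≥ Σ_{k<20}` suffices (no closed form / tail for `C`); the Lerch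
values `Φ(log p) = Σ_k p^{−2k}(k+¼)^{−2}` (`p = 2, 3, 3/2`) are geometric (8–10 terms, two-sided);
`Ψ(log 3)` carries the prime term `(log 2)(log 3 − log 2)/√2`; constants `√p` via `(√p)² = p`,
`log 2` (Mathlib), `1.0986 < log 3 < 1.0987`, `1.144 < log π < 1.1448`, `γ₀` (tree, 1e−7).
Main: `zetaScrew_log_eq_sqrt`, `zetaScrewPrimeSum_log_three`, `zetaScrew_log_{two,three,three_halves}_sub_bounds`
(`Ψ(log p) − C/4` to ±3e−4), **`screwDet_two_pos`**, **`screwPivot_three_pos`**, **`screwMatrix_two_posDef`**.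
Nothing here bears on the truth of RH (each rung is an RH-consequence certificate made unconditional by
computation). Reference for `Ψ`: M. Suzuki, J. Lond. Math. Soc. (2) 108 (2023) = arXiv:2206.03682, (1.1)
[Suzuki2023].
-/

noncomputable section

-- D-0017: `Summit.<S>.<S>.…` is the designed namespace of a single-problem summit.
set_option linter.dupNamespace false

namespace Summit.RiemannHypothesis.RiemannHypothesis.Theorems.IntegerScrew

open Literature.NumberTheory.LFunctions Finset
open scoped BigOperators

/-- Product of two interval-bounded non-negative quantities. [folklore] -/
private theorem mul_bounds {x y a b c d : ℝ} (ha : a ≤ x) (hb : x ≤ b) (hc : c ≤ y) (hd : y ≤ d)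
    (ha0 : 0 ≤ a) (hc0 : 0 ≤ c) : a * c ≤ x * y ∧ x * y ≤ b * d :=
  ⟨mul_le_mul ha hc hc0 (le_trans ha0 ha), mul_le_mul hb hd (le_trans hc0 hc) (le_trans ha0 (le_trans ha hb))⟩

/-- `log π < 1.1448`. [folklore] -/
private theorem log_pi_lt' : Real.log Real.pi < 1.1448 := by
  rw [Real.log_lt_iff_lt_exp Real.pi_pos]
  have h1 : (1.15578 : ℝ) ≤ Real.exp 0.1448 := by
    have := Real.sum_le_exp_of_nonneg (show (0 : ℝ) ≤ 0.1448 by norm_num) 4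
    norm_num [Finset.sum_range_succ, Nat.factorial] at this ⊢
    linarith
  have h2 : Real.exp (1.1448 : ℝ) = Real.exp 1 * Real.exp 0.1448 := by
    rw [← Real.exp_add]; norm_num
  calc Real.pi < 3.141593 := Real.pi_lt_d6
    _ < 2.7182818283 * 1.15578 := by norm_num
    _ ≤ Real.exp 1 * Real.exp 0.1448 :=
        mul_le_mul Real.exp_one_gt_d9.le h1 (by norm_num) (Real.exp_pos 1).le
    _ = Real.exp 1.1448 := h2.symm

/-- `1.144 < log π`. [folklore] -/
private theorem lt_log_pi' : (1.144 : ℝ) < Real.log Real.pi := by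
  rw [Real.lt_log_iff_exp_lt Real.pi_pos]
  have h1 : Real.exp (0.144 : ℝ) ≤ 1.15504 := by
    have := Real.exp_bound' (show (0 : ℝ) ≤ 0.144 by norm_num) (show (0.144 : ℝ) ≤ 1 by norm_num)
      (n := 3) (by norm_num)
    norm_num [Finset.sum_range_succ, Nat.factorial] at this ⊢
    linarith
  have h2 : Real.exp (1.144 : ℝ) = Real.exp 1 * Real.exp 0.144 := by
    rw [← Real.exp_add]; norm_num
  calc Real.exp (1.144 : ℝ) = Real.exp 1 * Real.exp 0.144 := h2
    _ ≤ 2.7182818286 * 1.15504 :=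
        mul_le_mul Real.exp_one_lt_d9.le h1 (Real.exp_pos _).le (by norm_num)
    _ < 3.141592 := by norm_num
    _ < Real.pi := Real.pi_gt_d6

/-- `5.3714 < A < 5.3723` for `A = γ₀ + π/2 + 3 log 2 + log π`. [folklore] -/
private theorem slope_bounds :
    (5.3714 : ℝ) < Real.eulerMascheroniConstant + Real.pi / 2 + 3 * Real.log 2 + Real.log Real.pi ∧
    Real.eulerMascheroniConstant + Real.pi / 2 + 3 * Real.log 2 + Real.log Real.pi < 5.3723 := by
  have h1 := Literature.Analysis.SpecialFunctions.Real.eulerMascheroniConstant_gt_d8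
  have h2 := Literature.Analysis.SpecialFunctions.Real.eulerMascheroniConstant_lt_d8
  have h7 := lt_log_pi'; have h8 := log_pi_lt'
  constructor <;> linarith [Real.pi_gt_d6, Real.pi_lt_d6, Real.log_two_gt_d9, Real.log_two_lt_d9]

/-- `1.0986 < log 3 < 1.0987`. [folklore] -/
private theorem log_three_bounds : (1.0986 : ℝ) < Real.log 3 ∧ Real.log 3 < 1.0987 := by
  constructor
  · rw [Real.lt_log_iff_exp_lt (by norm_num)]
    have h1 : Real.exp (0.0986 : ℝ) ≤ 1.103626 := by
      have := Real.exp_bound' (show (0 : ℝ) ≤ 0.0986 by norm_num) (show (0.0986 : ℝ) ≤ 1 by norm_num)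
        (n := 4) (by norm_num)
      norm_num [Finset.sum_range_succ, Nat.factorial] at this ⊢
      linarith
    have h2 : Real.exp (1.0986 : ℝ) = Real.exp 1 * Real.exp 0.0986 := by
      rw [← Real.exp_add]; norm_num
    calc Real.exp (1.0986 : ℝ) = Real.exp 1 * Real.exp 0.0986 := h2
      _ ≤ 2.7182818286 * 1.103626 :=
          mul_le_mul Real.exp_one_lt_d9.le h1 (Real.exp_pos _).le (by norm_num)
      _ < 3 := by norm_num
  · rw [Real.log_lt_iff_lt_exp (by norm_num)]
    have h1 : (1.103734 : ℝ) ≤ Real.exp 0.0987 := by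
      have := Real.sum_le_exp_of_nonneg (show (0 : ℝ) ≤ 0.0987 by norm_num) 5
      norm_num [Finset.sum_range_succ, Nat.factorial] at this ⊢
      linarith
    have h2 : Real.exp (1.0987 : ℝ) = Real.exp 1 * Real.exp 0.0987 := by
      rw [← Real.exp_add]; norm_num
    calc (3 : ℝ) < 2.7182818283 * 1.103734 := by norm_num
      _ ≤ Real.exp 1 * Real.exp 0.0987 :=
          mul_le_mul Real.exp_one_gt_d9.le h1 (by norm_num) (Real.exp_pos 1).le
      _ = Real.exp 1.0987 := h2.symm

/-- For `p > 0`: `e^{−2|log p|k} = ((p²)⁻¹)^k` when `p ≥ 1`. [folklore] -/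
private theorem exp_neg_two_mul_log (p : ℝ) (hp : 1 ≤ p) (k : ℕ) :
    Real.exp (-(2 * |Real.log p| * k)) = ((p ^ 2)⁻¹) ^ k := by
  have hp0 : 0 < p := by linarith
  rw [abs_of_nonneg (Real.log_nonneg hp),
    show -(2 * Real.log p * k) = (k : ℝ) * (-(2 * Real.log p)) by ring, Real.exp_nat_mul,
    Real.exp_neg, show 2 * Real.log p = ((2 : ℕ) : ℝ) * Real.log p by norm_num, Real.exp_nat_mul,
    Real.exp_log hp0]

/-- `Φ(log p) = Σ_k ((p²)⁻¹)^k/(k+¼)²` for `p ≥ 1`. [folklore] -/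
private theorem hurwitzLerchQuarter_log {p : ℝ} (hp : 1 ≤ p) :
    hurwitzLerchQuarter (Real.log p) = ∑' k : ℕ, ((p ^ 2)⁻¹) ^ k / ((k : ℝ) + 1 / 4) ^ 2 := by
  unfold hurwitzLerchQuarter
  exact tsum_congr fun k => by rw [exp_neg_two_mul_log p hp k]

/-- Summability of `r^k/(k+¼)²` for `0 ≤ r ≤ 1`. [folklore] -/
private theorem summable_geom_lerch {r : ℝ} (hr0 : 0 ≤ r) (hr1 : r ≤ 1) :
    Summable fun k : ℕ => r ^ k / ((k : ℝ) + 1 / 4) ^ 2 := by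
  refine summable_one_div_nat_add_quarter_sq.of_nonneg_of_le (fun k => by positivity) fun k => ?_
  exact div_le_div_of_nonneg_right (pow_le_one₀ hr0 hr1) (by positivity)

/-- Lower bound by a partial sum. [folklore] -/
private theorem sum_le_geom_lerch {r : ℝ} (hr0 : 0 ≤ r) (hr1 : r ≤ 1) (K : ℕ) :
    ∑ k ∈ Finset.range K, r ^ k / ((k : ℝ) + 1 / 4) ^ 2 ≤ ∑' k : ℕ, r ^ k / ((k : ℝ) + 1 / 4) ^ 2 :=
  (summable_geom_lerch hr0 hr1).sum_le_tsum _ fun k _ => by positivity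

/-- Upper bound: partial sum plus a geometric tail `r^K/((K+¼)²(1−r))`. [folklore] -/
private theorem geom_lerch_le {r : ℝ} (hr0 : 0 ≤ r) (hr1 : r < 1) (K : ℕ) :
    ∑' k : ℕ, r ^ k / ((k : ℝ) + 1 / 4) ^ 2 ≤
      ∑ k ∈ Finset.range K, r ^ k / ((k : ℝ) + 1 / 4) ^ 2 + r ^ K / (((K : ℝ) + 1 / 4) ^ 2 * (1 - r)) := by
  have hs := summable_geom_lerch hr0 hr1.le
  rw [← hs.sum_add_tsum_nat_add K]
  refine add_le_add le_rfl ?_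
  have hgeom : Summable fun i : ℕ => r ^ K / ((K : ℝ) + 1 / 4) ^ 2 * r ^ i :=
    (summable_geometric_of_lt_one hr0 hr1).mul_left _
  have hterm : ∀ i : ℕ, r ^ (i + K) / (((i + K : ℕ) : ℝ) + 1 / 4) ^ 2
      ≤ r ^ K / ((K : ℝ) + 1 / 4) ^ 2 * r ^ i := by
    intro i
    have hi : (0 : ℝ) ≤ i := Nat.cast_nonneg i
    have hK : (0 : ℝ) ≤ K := Nat.cast_nonneg K
    have hDK : (0 : ℝ) < ((K : ℝ) + 1 / 4) ^ 2 := by positivity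
    have hinv : (((i : ℝ) + K + 1 / 4) ^ 2)⁻¹ ≤ (((K : ℝ) + 1 / 4) ^ 2)⁻¹ :=
      inv_anti₀ hDK (pow_le_pow_left₀ (by positivity) (by linarith) 2)
    calc r ^ (i + K) / (((i + K : ℕ) : ℝ) + 1 / 4) ^ 2
        = r ^ K * r ^ i * (((i : ℝ) + K + 1 / 4) ^ 2)⁻¹ := by
          push_cast; rw [pow_add, div_eq_mul_inv]; ring
      _ ≤ r ^ K * r ^ i * (((K : ℝ) + 1 / 4) ^ 2)⁻¹ :=
          mul_le_mul_of_nonneg_left hinv (by positivity)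
      _ = r ^ K / ((K : ℝ) + 1 / 4) ^ 2 * r ^ i := by rw [div_eq_mul_inv]; ring
  calc ∑' i : ℕ, r ^ (i + K) / (((i + K : ℕ) : ℝ) + 1 / 4) ^ 2
      ≤ ∑' i : ℕ, r ^ K / ((K : ℝ) + 1 / 4) ^ 2 * r ^ i :=
        Summable.tsum_le_tsum hterm ((summable_nat_add_iff K).mpr hs) hgeom
    _ = r ^ K / ((K : ℝ) + 1 / 4) ^ 2 * ∑' i : ℕ, r ^ i := tsum_mul_left
    _ = r ^ K / (((K : ℝ) + 1 / 4) ^ 2 * (1 - r)) := by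
        rw [tsum_geometric_of_lt_one hr0 hr1]; field_simp

/-- `Φ(log 2) ∈ [16.174084, 16.1740844]`. [folklore] -/
private theorem lerch_two_bounds :
    (16.174084 : ℝ) ≤ ∑' k : ℕ, (((2:ℝ) ^ 2)⁻¹) ^ k / ((k : ℝ) + 1 / 4) ^ 2 ∧
    ∑' k : ℕ, (((2:ℝ) ^ 2)⁻¹) ^ k / ((k : ℝ) + 1 / 4) ^ 2 ≤ 16.1740844 := by
  constructor
  · refine le_trans ?_ (sum_le_geom_lerch (by norm_num) (by norm_num) 8)
    norm_num [Finset.sum_range_succ]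
  · refine le_trans (geom_lerch_le (by norm_num) (by norm_num) 8) ?_
    norm_num [Finset.sum_range_succ]

/-- `Φ(log 3) ∈ [16.0736887, 16.0736888]`. [folklore] -/
private theorem lerch_three_bounds :
    (16.0736887 : ℝ) ≤ ∑' k : ℕ, (((3:ℝ) ^ 2)⁻¹) ^ k / ((k : ℝ) + 1 / 4) ^ 2 ∧
    ∑' k : ℕ, (((3:ℝ) ^ 2)⁻¹) ^ k / ((k : ℝ) + 1 / 4) ^ 2 ≤ 16.0736888 := by
  constructor
  · refine le_trans ?_ (sum_le_geom_lerch (by norm_num) (by norm_num) 8)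
    norm_num [Finset.sum_range_succ]
  · refine le_trans (geom_lerch_le (by norm_num) (by norm_num) 8) ?_
    norm_num [Finset.sum_range_succ]

/-- `Φ(log(3/2)) ∈ [16.3348566, 16.3348618]`. [folklore] -/
private theorem lerch_three_halves_bounds :
    (16.3348566 : ℝ) ≤ ∑' k : ℕ, (((3/2:ℝ) ^ 2)⁻¹) ^ k / ((k : ℝ) + 1 / 4) ^ 2 ∧
    ∑' k : ℕ, (((3/2:ℝ) ^ 2)⁻¹) ^ k / ((k : ℝ) + 1 / 4) ^ 2 ≤ 16.3348618 := by
  constructor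
  · refine le_trans ?_ (sum_le_geom_lerch (by norm_num) (by norm_num) 10)
    norm_num [Finset.sum_range_succ]
  · refine le_trans (geom_lerch_le (by norm_num) (by norm_num) 10) ?_
    norm_num [Finset.sum_range_succ]

/-- `C = Σ_k (k+¼)^{−2} ≥ 17.1467` (twenty terms). [folklore] -/
private theorem lerch_const_ge : (17.1467 : ℝ) ≤ ∑' k : ℕ, 1 / ((k : ℝ) + 1 / 4) ^ 2 := by
  refine le_trans ?_ (summable_one_div_nat_add_quarter_sq.sum_le_tsum (Finset.range 20)
    fun k _ => by positivity)
  norm_num [Finset.sum_range_succ]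

/-- `Ψ(log p) = 4(√p + √p/p − 2) − P(log p) − (log p/2)·A + ¼(C − (√p/p)·Σ_k (p²)^{−k}(k+¼)^{−2})`, `p ≥ 1`. [folklore] -/
theorem zetaScrew_log_eq_sqrt {p : ℝ} (hp : 1 ≤ p) :
    zetaScrew (Real.log p) = 4 * (Real.sqrt p + Real.sqrt p / p - 2) - zetaScrewPrimeSum (Real.log p)
      - Real.log p / 2 * (Real.eulerMascheroniConstant + Real.pi / 2 + 3 * Real.log 2 + Real.log Real.pi)
      + 1 / 4 * ((∑' k : ℕ, 1 / ((k : ℝ) + 1 / 4) ^ 2)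
        - Real.sqrt p / p * ∑' k : ℕ, ((p ^ 2)⁻¹) ^ k / ((k : ℝ) + 1 / 4) ^ 2) := by
  have hp0 : 0 < p := by linarith
  have habs : |Real.log p| = Real.log p := abs_of_nonneg (Real.log_nonneg hp)
  have hsq : Real.exp (Real.log p / 2) = Real.sqrt p := by
    rw [Real.sqrt_eq_rpow, Real.rpow_def_of_pos hp0]; ring_nf
  have hsq' : Real.exp (-(Real.log p / 2)) = Real.sqrt p / p := by
    rw [Real.exp_neg, hsq]
    have hs : Real.sqrt p ≠ 0 := (Real.sqrt_pos.mpr hp0).ne'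
    field_simp
    rw [Real.sq_sqrt hp0.le]
  rw [zetaScrew_eq, habs, hsq, hsq', hurwitzLerchQuarter_log hp]

/-- `P(log 3) = (log 2)(log 3 − log 2)/√2` (the only prime power `≤ 3` below `3` is `2`). [folklore] -/
theorem zetaScrewPrimeSum_log_three :
    zetaScrewPrimeSum (Real.log 3) = Real.log 2 / Real.sqrt 2 * (Real.log 3 - Real.log 2) := by
  have hl3 : 0 < Real.log 3 := Real.log_pos (by norm_num)
  unfold zetaScrewPrimeSum
  rw [abs_of_pos hl3, Real.exp_log (by norm_num : (0:ℝ) < 3)]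
  have hfl : ⌊(3 : ℝ)⌋₊ = 3 := by norm_num
  rw [hfl, show Finset.Icc (1 : ℕ) 3 = {1, 2, 3} from by decide]
  rw [Finset.sum_insert (by decide), Finset.sum_pair (by norm_num)]
  have h1 : ArithmeticFunction.vonMangoldt 1 = 0 := ArithmeticFunction.vonMangoldt_apply_one
  have h2 : ArithmeticFunction.vonMangoldt 2 = Real.log 2 := by
    rw [ArithmeticFunction.vonMangoldt_apply_prime Nat.prime_two]; norm_num
  have h3 : ArithmeticFunction.vonMangoldt 3 = Real.log 3 := by
    rw [ArithmeticFunction.vonMangoldt_apply_prime Nat.prime_three]; norm_num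
  rw [h1, h2, h3]
  push_cast
  ring

/-- `Ψ(log 2) − C/4 ∈ [−4.2360, −4.2354]`. [folklore] -/
theorem zetaScrew_log_two_sub_bounds :
    (-4.2360 : ℝ) ≤ zetaScrew (Real.log 2) - (∑' k : ℕ, 1 / ((k : ℝ) + 1 / 4) ^ 2) / 4 ∧
    zetaScrew (Real.log 2) - (∑' k : ℕ, 1 / ((k : ℝ) + 1 / 4) ^ 2) / 4 ≤ -4.2354 := by
  rw [zetaScrew_log_eq_sqrt (by norm_num : (1:ℝ) ≤ 2), zetaScrewPrimeSum_log_two]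
  set s : ℝ := Real.sqrt 2 with hs
  have hs2 : s ^ 2 = 2 := Real.sq_sqrt (by norm_num)
  have hs0 : 0 < s := Real.sqrt_pos.mpr (by norm_num)
  have hslo : (1.41421 : ℝ) < s := by nlinarith
  have hshi : s < (1.41422 : ℝ) := by nlinarith
  have hA := slope_bounds; have hl := Real.log_two_gt_d9; have hl' := Real.log_two_lt_d9
  have hΦ := lerch_two_bounds
  set Φ := ∑' k : ℕ, (((2:ℝ) ^ 2)⁻¹) ^ k / ((k : ℝ) + 1 / 4) ^ 2 with hΦdef
  set A := Real.eulerMascheroniConstant + Real.pi / 2 + 3 * Real.log 2 + Real.log Real.pi with hAdef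
  have hp1 : 1.86157 ≤ Real.log 2 / 2 * A ∧ Real.log 2 / 2 * A ≤ 1.86194 := by
    have h := mul_bounds hl.le hl'.le hA.1.le hA.2.le (by norm_num) (by norm_num)
    constructor <;> linarith [h.1, h.2]
  have hp2 : 2.85919 ≤ s / 2 * Φ / 4 ∧ s / 2 * Φ / 4 ≤ 2.85922 := by
    have h := mul_bounds hslo.le hshi.le hΦ.1 hΦ.2 (by norm_num) (by norm_num)
    constructor <;> linarith [h.1, h.2]
  have ht1 : 0.48526 ≤ 4 * (s + s / 2 - 2) ∧ 4 * (s + s / 2 - 2) ≤ 0.48532 := by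
    constructor <;> linarith
  constructor <;> linarith [hp1.1, hp1.2, hp2.1, hp2.2, ht1.1, ht1.2]

/-- `Ψ(log 3) − C/4 ∈ [−4.2326, −4.2315]`. [folklore] -/
theorem zetaScrew_log_three_sub_bounds :
    (-4.2326 : ℝ) ≤ zetaScrew (Real.log 3) - (∑' k : ℕ, 1 / ((k : ℝ) + 1 / 4) ^ 2) / 4 ∧
    zetaScrew (Real.log 3) - (∑' k : ℕ, 1 / ((k : ℝ) + 1 / 4) ^ 2) / 4 ≤ -4.2315 := by
  rw [zetaScrew_log_eq_sqrt (by norm_num : (1:ℝ) ≤ 3), zetaScrewPrimeSum_log_three]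
  set s : ℝ := Real.sqrt 3 with hs
  have hs2 : s ^ 2 = 3 := Real.sq_sqrt (by norm_num)
  have hs0 : 0 < s := Real.sqrt_pos.mpr (by norm_num)
  have hslo : (1.73205 : ℝ) < s := by nlinarith
  have hshi : s < (1.73206 : ℝ) := by nlinarith
  set r : ℝ := Real.sqrt 2 with hr
  have hr2 : r ^ 2 = 2 := Real.sq_sqrt (by norm_num)
  have hr0 : 0 < r := Real.sqrt_pos.mpr (by norm_num)
  have hrlo : (1.41421 : ℝ) < r := by nlinarith
  have hrhi : r < (1.41422 : ℝ) := by nlinarith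
  have hA := slope_bounds; have hl := Real.log_two_gt_d9; have hl' := Real.log_two_lt_d9
  have hl3 := log_three_bounds; have hΦ := lerch_three_bounds
  set Φ := ∑' k : ℕ, (((3:ℝ) ^ 2)⁻¹) ^ k / ((k : ℝ) + 1 / 4) ^ 2 with hΦdef
  set A := Real.eulerMascheroniConstant + Real.pi / 2 + 3 * Real.log 2 + Real.log Real.pi with hAdef
  have hrinv : Real.log 2 / r = r / 2 * Real.log 2 := by
    field_simp; nlinarith
  rw [hrinv]
  have hq1 : 0.19872 ≤ r / 2 * Real.log 2 * (Real.log 3 - Real.log 2) ∧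
      r / 2 * Real.log 2 * (Real.log 3 - Real.log 2) ≤ 0.19878 := by
    have h1 := mul_bounds hrlo.le hrhi.le hl.le hl'.le (by norm_num) (by norm_num)
    have hd1 : (0.4054528 : ℝ) ≤ Real.log 3 - Real.log 2 := by linarith [hl3.1]
    have hd2 : Real.log 3 - Real.log 2 ≤ 0.4055529 := by linarith [hl3.2]
    have h2 := mul_bounds h1.1 h1.2 hd1 hd2 (by norm_num) (by norm_num)
    constructor <;> linarith [h2.1, h2.2]
  have hp1 : 2.95051 ≤ Real.log 3 / 2 * A ∧ Real.log 3 / 2 * A ≤ 2.95128 := by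
    have h := mul_bounds hl3.1.le hl3.2.le hA.1.le hA.2.le (by norm_num) (by norm_num)
    constructor <;> linarith [h.1, h.2]
  have hp2 : 2.32003 ≤ s / 3 * Φ / 4 ∧ s / 3 * Φ / 4 ≤ 2.32005 := by
    have h := mul_bounds hslo.le hshi.le hΦ.1 hΦ.2 (by norm_num) (by norm_num)
    constructor <;> linarith [h.1, h.2]
  have ht1 : 1.2376 ≤ 4 * (s + s / 3 - 2) ∧ 4 * (s + s / 3 - 2) ≤ 1.23766 := by
    constructor <;> linarith
  constructor <;> linarith [hp1.1, hp1.2, hp2.1, hp2.2, hq1.1, hq1.2, ht1.1, ht1.2]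

/-- `Ψ(log(3/2)) − C/4 ∈ [−4.2589, −4.2582]`. [folklore] -/
theorem zetaScrew_log_three_halves_sub_bounds :
    (-4.2589 : ℝ) ≤ zetaScrew (Real.log (3 / 2)) - (∑' k : ℕ, 1 / ((k : ℝ) + 1 / 4) ^ 2) / 4 ∧
    zetaScrew (Real.log (3 / 2)) - (∑' k : ℕ, 1 / ((k : ℝ) + 1 / 4) ^ 2) / 4 ≤ -4.2582 := by
  have hprime : zetaScrewPrimeSum (Real.log (3 / 2)) = 0 := by
    apply zetaScrewPrimeSum_eq_zero_of_abs_lt_log_two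
    rw [abs_of_pos (Real.log_pos (by norm_num))]
    exact Real.log_lt_log (by norm_num) (by norm_num)
  rw [zetaScrew_log_eq_sqrt (by norm_num : (1:ℝ) ≤ 3 / 2), hprime,
    Real.log_div (by norm_num) (by norm_num)]
  set s : ℝ := Real.sqrt (3 / 2) with hs
  have hs2 : s ^ 2 = 3 / 2 := Real.sq_sqrt (by norm_num)
  have hs0 : 0 < s := Real.sqrt_pos.mpr (by norm_num)
  have hslo : (1.224744 : ℝ) < s := by nlinarith
  have hshi : s < (1.224746 : ℝ) := by nlinarith
  have hA := slope_bounds; have hl := Real.log_two_gt_d9; have hl' := Real.log_two_lt_d9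
  have hl3 := log_three_bounds; have hΦ := lerch_three_halves_bounds
  set Φ := ∑' k : ℕ, (((3/2:ℝ) ^ 2)⁻¹) ^ k / ((k : ℝ) + 1 / 4) ^ 2 with hΦdef
  set A := Real.eulerMascheroniConstant + Real.pi / 2 + 3 * Real.log 2 + Real.log Real.pi with hAdef
  have hp1 : 1.08892 ≤ (Real.log 3 - Real.log 2) / 2 * A ∧
      (Real.log 3 - Real.log 2) / 2 * A ≤ 1.08938 := by
    have hd1 : (0.4054528 : ℝ) ≤ Real.log 3 - Real.log 2 := by linarith [hl3.1]
    have hd2 : Real.log 3 - Real.log 2 ≤ 0.4055529 := by linarith [hl3.2]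
    have h := mul_bounds hd1 hd2 hA.1.le hA.2.le (by norm_num) (by norm_num)
    constructor <;> linarith [h.1, h.2]
  have hp2 : 3.33432 ≤ s / (3 / 2) * Φ / 4 ∧ s / (3 / 2) * Φ / 4 ≤ 3.334356 := by
    have h := mul_bounds hslo.le hshi.le hΦ.1 hΦ.2 (by norm_num) (by norm_num)
    constructor <;> linarith [h.1, h.2]
  have ht1 : 0.16493 ≤ 4 * (s + s / (3 / 2) - 2) ∧ 4 * (s + s / (3 / 2) - 2) ≤ 0.165 := by
    constructor <;> linarith
  constructor <;> linarith [hp1.1, hp1.2, hp2.1, hp2.2, ht1.1, ht1.2]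

/-- `det S_3 = (2Ψ(log 2))(2Ψ(log 3)) − (Ψ(log 2) + Ψ(log 3) − Ψ(log(3/2)))²`. [folklore] -/
theorem screwDet_two_eq :
    screwDet 2 = (2 * zetaScrew (Real.log 2)) * (2 * zetaScrew (Real.log 3))
      - (zetaScrew (Real.log 2) + zetaScrew (Real.log 3) - zetaScrew (Real.log (3 / 2))) ^ 2 := by
  have hlog : Real.log 2 - Real.log 3 = -Real.log (3 / 2) := by
    rw [Real.log_div (by norm_num) (by norm_num)]; ring
  have hb : zetaScrewKernel (Real.log 2) (Real.log 3)
      = zetaScrew (Real.log 2) + zetaScrew (Real.log 3) - zetaScrew (Real.log (3 / 2)) := by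
    rw [zetaScrewKernel_def, hlog, zetaScrew_neg]
  have hb' : zetaScrewKernel (Real.log 3) (Real.log 2)
      = zetaScrew (Real.log 2) + zetaScrew (Real.log 3) - zetaScrew (Real.log (3 / 2)) := by
    rw [zetaScrewKernel_comm, hb]
  have h2 : (((((0 : Fin 2) : ℕ) + 2 : ℕ)) : ℝ) = 2 := by norm_num
  have h3 : (((((1 : Fin 2) : ℕ) + 2 : ℕ)) : ℝ) = 3 := by norm_num
  rw [screwDet, Matrix.det_fin_two, screwMatrix_apply, screwMatrix_apply, screwMatrix_apply,
    screwMatrix_apply, h2, h3, zetaScrewKernel_self, zetaScrewKernel_self, hb, hb']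
  ring

/-- `det S_2 = 2Ψ(log 2)`. [folklore] -/
theorem screwDet_one_eq : screwDet 1 = 2 * zetaScrew (Real.log 2) := by
  rw [screwDet, Matrix.det_fin_one, screwMatrix_diag]
  norm_num

/-- **`det S_3 > 0`, unconditionally** (numerically `0.008999`; certified here `> 0.004`). [folklore] -/
theorem screwDet_two_pos : 0 < screwDet 2 := by
  rw [screwDet_two_eq]
  set C : ℝ := ∑' k : ℕ, 1 / ((k : ℝ) + 1 / 4) ^ 2 with hC
  have hC0 := lerch_const_ge; have h2 := zetaScrew_log_two_sub_bounds
  have h3 := zetaScrew_log_three_sub_bounds; have h32 := zetaScrew_log_three_halves_sub_bounds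
  set u : ℝ := zetaScrew (Real.log 2) - C / 4 with hu
  set v : ℝ := zetaScrew (Real.log 3) - C / 4 with hv
  set w : ℝ := zetaScrew (Real.log (3 / 2)) - C / 4 with hw
  set δ : ℝ := C - 17.1467 with hδ
  have hδ0 : 0 ≤ δ := by rw [hδ]; linarith
  have ea : zetaScrew (Real.log 2) = 17.1467 / 4 + δ / 4 + u := by rw [hu, hδ]; ring
  have ec : zetaScrew (Real.log 3) = 17.1467 / 4 + δ / 4 + v := by rw [hv, hδ]; ring
  have eb : zetaScrew (Real.log (3 / 2)) = 17.1467 / 4 + δ / 4 + w := by rw [hw, hδ]; ring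
  rw [ea, ec, eb]
  have ha0 : (0.10135 : ℝ) ≤ 17.1467 / 2 + 2 * u := by linarith [h2.1]
  have hc0 : (0.10815 : ℝ) ≤ 17.1467 / 2 + 2 * v := by linarith [h3.1]
  have hb0 : 17.1467 / 4 + u + v - w ≤ (0.07868 : ℝ) := by linarith [h2.2, h3.2, h32.1]
  have hb0' : (0 : ℝ) ≤ 17.1467 / 4 + u + v - w := by linarith [h2.1, h3.1, h32.2]
  have hsum : (0 : ℝ) ≤ (17.1467 / 2 + 2 * u) + (17.1467 / 2 + 2 * v) - (17.1467 / 4 + u + v - w) := by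
    linarith [h2.1, h3.1, h32.2]
  have hprod : (0.10135 : ℝ) * 0.10815 ≤ (17.1467 / 2 + 2 * u) * (17.1467 / 2 + 2 * v) :=
    mul_le_mul ha0 hc0 (by norm_num) (by linarith)
  have hsq : (17.1467 / 4 + u + v - w) ^ 2 ≤ (0.07868 : ℝ) ^ 2 :=
    pow_le_pow_left₀ hb0' hb0 2
  nlinarith [mul_nonneg hδ0 hsum, sq_nonneg δ, mul_nonneg hδ0 hδ0]

/-- **`d_3 > 0`, unconditionally** (second rung of the RH-equivalent pivot ladder; `d_3 = 0.07079…`). [folklore] -/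
theorem screwPivot_three_pos : 0 < screwPivot 3 := by
  rw [show (3 : ℕ) = 1 + 2 from rfl, screwPivot_add_two, screwDet_one_eq]
  exact div_pos screwDet_two_pos (by have := zetaScrew_log_two_pos; linarith)

/-- **`S_3 ≻ 0`, unconditionally** (the `2 × 2` screw Gram matrix on `log 2, log 3`). [folklore] -/
theorem screwMatrix_two_posDef : (screwMatrix 2).PosDef := by
  refine screwMatrix_posDef_of_screwPivot_pos_le 2 (fun M h2 h3 => ?_) 2 le_rfl
  interval_cases M
  · exact screwPivot_two_pos
  · exact screwPivot_three_pos

end Summit.RiemannHypothesis.RiemannHypothesis.Theorems.IntegerScrew
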